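import Literature.Geometry.DiscreteGeometry.SphericalPolygonArea
import HarnessLib

/-!
# Gluing convex spherical polygons: the chirotope lemmas behind LEMMA L (faces of the tight
# graph are convex) — an ear, or a second convex polygon, glued along a side with convex corners
# at its two ends gives a convex polygon

HONEST FRAMING. Part of the venture `Summits/Ventures/Crystal3D` (cell `pub-crystal3d`, phase 2;
seat p3), configuration-free: everything here is about finite sequences of vectors of `ℝ³` and
the orientation `orient3` (the `3 × 3` determinant, `Literature…SphericalPolygonPerimeter.lean`).
Nothing is claimed about GAP(1.26). A sequence `w 0, …, w (n−1)` is in CONVEX POSITION when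
every increasingly indexed triple is positively oriented,
`∀ i < j < k < n, 0 < orient3 (w i) (w j) (w k)` — verbatim the hypothesis of the tree's Euclid
XI.21 `sum_angle_lt_two_pi_of_orient3_pos` (perimeter `< 2π`, whence the face-size rows
P-L3(c) of the cell's `DESIGN-L12-THEORY.md`) and of Girard `ballFraction_polyCone`; it says that
the rays `ℝ₊ w i` are, in this cyclic order, the edges of a convex polyhedral angle. LEMMA L of
the cell file (every face of the tight graph `T′` is such a polygon) is proved there by an EAR
INDUCTION over the hull triangulation of the face, whose geometric step is: a convex polygon `F′`
and a triangle `Δ` glued along a common side, with the two corners of `F′ ∪ Δ` at the ends of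
that side `< 180°`, form a convex polygon (steps (α) "`F′ ∪ Δ` lies in an open hemisphere" and
(β) "gnomonic projection + planar convexity"). This file proves that step — and the gluing of two
convex polygons along a side — DIRECTLY ON THE SPHERE, with no hemisphere, chart or case split,
by sign-chasing the three-term Grassmann–Plücker relation of the tree
(`orient3_three_term : det[p;a;b]·det[p;c;x] = det[p;c;b]·det[p;a;x] + det[p;a;c]·det[p;b;x]`):

* **`convexPos_snoc`** (EAR GLUING) — if `w 0, …, w (n−1)` (`n ≥ 3`) is in convex position and
  the new vertex `w n` satisfies the three LOCAL sign conditions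
  `0 < orient3 (w (n−2)) (w (n−1)) (w n)` (the corner of the glued polygon at `w (n−1)` is
  `< 180°`), `0 < orient3 (w (n−1)) (w n) (w 0)` (the ear `w (n−1), w n, w 0` is a positively
  oriented triangle) and `0 < orient3 (w n) (w 0) (w 1)` (the corner at `w 0` is `< 180°`), then
  `w 0, …, w n` is in convex position. (Three Plücker steps: hub `w (n−1)` gives the triples
  `(i, n−1, n)`, hub `w 0` the triples `(0, j, n)`, hub `w i` the rest.)
* **`convexPos_glue`** (TWO-PIECE GLUING) — if `w 0, …, w (n−1)` (`n ≥ 3`) is in convex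
  position, the cycle `w (n−1), w n, …, w (n+m−1), w 0` is in convex position (a second convex
  polygon sharing the side `w (n−1) w 0`, traversed so that both lie to the left), and the two
  corners of the union at `w (n−1)` and at `w 0` are convex
  (`0 < orient3 (w (n−2)) (w (n−1)) (w n)`, `0 < orient3 (w (n+m−1)) (w 0) (w 1)`), then
  `w 0, …, w (n+m−1)` is in convex position (induction on `m` by ears; the intermediate corner
  condition at `w 0` is one more Plücker step at hub `w 0`).
* `convexPos_rotate`, `convexPos_of_lt` — convex position is invariant under cyclic rotation of
  the indexing and inherited by initial segments (bookkeeping the face layer needs to place the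
  ear anywhere on the cycle).
-/

noncomputable section

namespace Summit.Ventures.Crystal3D

open Literature.Geometry.DiscreteGeometry

/-! ## Bookkeeping: cyclic reorderings, initial segments, rotation -/

/-- In convex position, a cyclically increasing triple `(j, k, i)` with `i < j < k` is positively
oriented too. -/
theorem convexPos_cyclic₁ {n : ℕ} {w : ℕ → EuclideanSpace ℝ (Fin 3)}
    (hw : ∀ i j k, i < j → j < k → k < n → 0 < orient3 (w i) (w j) (w k)) {i j k : ℕ}
    (hij : i < j) (hjk : j < k) (hk : k < n) : 0 < orient3 (w j) (w k) (w i) := by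
  rw [← orient3_cyclic]; exact hw i j k hij hjk hk

/-- In convex position, a cyclically increasing triple `(k, i, j)` with `i < j < k` is positively
oriented too. -/
theorem convexPos_cyclic₂ {n : ℕ} {w : ℕ → EuclideanSpace ℝ (Fin 3)}
    (hw : ∀ i j k, i < j → j < k → k < n → 0 < orient3 (w i) (w j) (w k)) {i j k : ℕ}
    (hij : i < j) (hjk : j < k) (hk : k < n) : 0 < orient3 (w k) (w i) (w j) := by
  rw [orient3_cyclic]; exact hw i j k hij hjk hk

/-- Convex position is inherited by initial segments. -/
theorem convexPos_of_le {n n' : ℕ} {w : ℕ → EuclideanSpace ℝ (Fin 3)} (hle : n' ≤ n)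
    (hw : ∀ i j k, i < j → j < k → k < n → 0 < orient3 (w i) (w j) (w k)) :
    ∀ i j k, i < j → j < k → k < n' → 0 < orient3 (w i) (w j) (w k) :=
  fun i j k hij hjk hk => hw i j k hij hjk (lt_of_lt_of_le hk hle)

/-- Convex position depends only on the values `w i`, `i < n`. -/
theorem convexPos_congr {n : ℕ} {w w' : ℕ → EuclideanSpace ℝ (Fin 3)} (h : ∀ i, i < n → w' i = w i)
    (hw : ∀ i j k, i < j → j < k → k < n → 0 < orient3 (w i) (w j) (w k)) :
    ∀ i j k, i < j → j < k → k < n → 0 < orient3 (w' i) (w' j) (w' k) := by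
  intro i j k hij hjk hk
  rw [h i (by omega), h j (by omega), h k hk]
  exact hw i j k hij hjk hk

/-- **Convex position is invariant under cyclic rotation of the indices.** -/
theorem convexPos_rotate {n : ℕ} {w : ℕ → EuclideanSpace ℝ (Fin 3)}
    (hw : ∀ i j k, i < j → j < k → k < n → 0 < orient3 (w i) (w j) (w k)) (r : ℕ) :
    ∀ i j k, i < j → j < k → k < n → 0 < orient3 (w ((i + r) % n)) (w ((j + r) % n))
      (w ((k + r) % n)) := by
  intro i j k hij hjk hk
  have hn : 0 < n := by omega
  set s := r % n with hs
  have hsn : s < n := Nat.mod_lt r hn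
  have hmod : ∀ x, (x + r) % n = (x + s) % n := fun x => by rw [hs, Nat.add_mod_mod]
  rw [hmod i, hmod j, hmod k]
  -- which of the three indices wrap around
  rcases Nat.lt_or_ge (k + s) n with hk' | hk'
  · -- none wraps
    rw [Nat.mod_eq_of_lt (by omega : i + s < n), Nat.mod_eq_of_lt (by omega : j + s < n),
      Nat.mod_eq_of_lt hk']
    exact hw _ _ _ (by omega) (by omega) hk'
  rcases Nat.lt_or_ge (j + s) n with hj' | hj'
  · -- only `k` wraps: `(k+s-n) < (i+s) < (j+s)`
    rw [Nat.mod_eq_of_lt (by omega : i + s < n), Nat.mod_eq_of_lt hj',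
      Nat.mod_eq_sub_mod hk', Nat.mod_eq_of_lt (by omega : k + s - n < n)]
    exact convexPos_cyclic₁ hw (i := k + s - n) (by omega) (by omega) hj'
  rcases Nat.lt_or_ge (i + s) n with hi' | hi'
  · -- `j` and `k` wrap: `(j+s-n) < (k+s-n) < (i+s)`
    rw [Nat.mod_eq_of_lt hi', Nat.mod_eq_sub_mod hj', Nat.mod_eq_of_lt (by omega : j + s - n < n),
      Nat.mod_eq_sub_mod hk', Nat.mod_eq_of_lt (by omega : k + s - n < n)]
    exact convexPos_cyclic₂ hw (i := j + s - n) (j := k + s - n) (by omega) (by omega) hi'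
  · -- all wrap
    rw [Nat.mod_eq_sub_mod hi', Nat.mod_eq_of_lt (by omega : i + s - n < n),
      Nat.mod_eq_sub_mod hj', Nat.mod_eq_of_lt (by omega : j + s - n < n),
      Nat.mod_eq_sub_mod hk', Nat.mod_eq_of_lt (by omega : k + s - n < n)]
    exact hw _ _ _ (by omega) (by omega) (by omega)

/-! ## Ear gluing -/

section Ear

variable {n : ℕ} {w : ℕ → EuclideanSpace ℝ (Fin 3)}

/-- Ear gluing, the triples through the glued side's far end `w (n−1)`: for `i < n − 1`,
`0 < orient3 (w i) (w (n−1)) (w n)` (Plücker at hub `w (n−1)` with `w (n−2)`, `w 0`). -/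
theorem convexPos_snoc_last (hn : 3 ≤ n)
    (hw : ∀ i j k, i < j → j < k → k < n → 0 < orient3 (w i) (w j) (w k))
    (h1 : 0 < orient3 (w (n - 2)) (w (n - 1)) (w n))
    (h2 : 0 < orient3 (w (n - 1)) (w n) (w 0)) {i : ℕ} (hi : i < n - 1) :
    0 < orient3 (w i) (w (n - 1)) (w n) := by
  rcases Nat.lt_or_ge i (n - 2) with hi2 | hi2
  swap
  · have hi' : i = n - 2 := by omega
    rw [hi']; exact h1
  -- Plücker at hub p = w (n-1): a = w n, b = w i, c = w (n-2), x = w 0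
  have hP := orient3_three_term (w (n - 1)) (w n) (w i) (w (n - 2)) (w 0)
  -- signs of the five other factors
  have s1 : orient3 (w (n - 1)) (w (n - 2)) (w 0) < 0 := by
    rw [orient3_swap_outer]
    have := hw 0 (n - 2) (n - 1) (by omega) (by omega) (by omega)
    linarith
  have s2 : orient3 (w (n - 1)) (w (n - 2)) (w i) < 0 := by
    rw [orient3_swap_outer]
    have := hw i (n - 2) (n - 1) hi2 (by omega) (by omega)
    linarith
  have s3 : 0 < orient3 (w (n - 1)) (w n) (w (n - 2)) := by
    rw [← orient3_cyclic]; exact h1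
  have s4 : orient3 (w (n - 1)) (w i) (w 0) ≤ 0 := by
    rcases Nat.eq_zero_or_pos i with rfl | hi0
    · rw [orient3_self_right]
    · rw [orient3_swap_outer]
      have := hw 0 i (n - 1) hi0 (by omega) (by omega)
      linarith
  -- conclude
  have hneg : orient3 (w (n - 1)) (w n) (w i) * orient3 (w (n - 1)) (w (n - 2)) (w 0) < 0 := by
    rw [hP]; nlinarith
  have hpos : 0 < orient3 (w (n - 1)) (w n) (w i) := by
    by_contra hle
    push Not at hle
    nlinarith
  rw [orient3_cyclic]; exact hpos

/-- Ear gluing, the triples through the glued side's near end `w 0`: for `0 < j < n`,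
`0 < orient3 (w 0) (w j) (w n)` (Plücker at hub `w 0` with `w 1`, `w (n−1)`). -/
theorem convexPos_snoc_zero (hn : 3 ≤ n)
    (hw : ∀ i j k, i < j → j < k → k < n → 0 < orient3 (w i) (w j) (w k))
    (h2 : 0 < orient3 (w (n - 1)) (w n) (w 0)) (h3 : 0 < orient3 (w n) (w 0) (w 1))
    {j : ℕ} (hj0 : 0 < j) (hj : j < n) : 0 < orient3 (w 0) (w j) (w n) := by
  have h2' : 0 < orient3 (w 0) (w (n - 1)) (w n) := by rw [orient3_cyclic]; exact h2
  have h3' : 0 < orient3 (w 0) (w 1) (w n) := by rw [← orient3_cyclic]; exact h3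
  rcases Nat.lt_or_ge j (n - 1) with hj2 | hj2
  swap
  · have hj' : j = n - 1 := by omega
    rw [hj']; exact h2'
  rcases Nat.lt_or_ge 1 j with hj1 | hj1
  swap
  · have hj' : j = 1 := by omega
    rw [hj']; exact h3'
  -- Plücker at hub p = w 0: a = w j, b = w n, c = w 1, x = w (n-1)
  have hP := orient3_three_term (w 0) (w j) (w n) (w 1) (w (n - 1))
  have s1 : 0 < orient3 (w 0) (w 1) (w (n - 1)) := hw 0 1 (n - 1) (by omega) (by omega) (by omega)
  have s2 : 0 < orient3 (w 0) (w j) (w (n - 1)) := hw 0 j (n - 1) hj0 hj2 (by omega)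
  have s3 : orient3 (w 0) (w j) (w 1) < 0 := by
    rw [orient3_swap_right]; have := hw 0 1 j (by omega) hj1 hj; linarith
  have s4 : orient3 (w 0) (w n) (w (n - 1)) < 0 := by
    rw [orient3_swap_right]; linarith
  have hpos : 0 < orient3 (w 0) (w j) (w n) * orient3 (w 0) (w 1) (w (n - 1)) := by
    rw [hP]; nlinarith
  by_contra hle
  push Not at hle
  nlinarith

/-- **EAR GLUING.** If `w 0, …, w (n−1)` (`n ≥ 3`) is in convex position and the new vertex `w n`
satisfies `0 < orient3 (w (n−2)) (w (n−1)) (w n)`, `0 < orient3 (w (n−1)) (w n) (w 0)` and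
`0 < orient3 (w n) (w 0) (w 1)` (corner at `w (n−1)` convex, the ear positively oriented, corner
at `w 0` convex), then `w 0, …, w n` is in convex position. -/
theorem convexPos_snoc (hn : 3 ≤ n)
    (hw : ∀ i j k, i < j → j < k → k < n → 0 < orient3 (w i) (w j) (w k))
    (h1 : 0 < orient3 (w (n - 2)) (w (n - 1)) (w n))
    (h2 : 0 < orient3 (w (n - 1)) (w n) (w 0)) (h3 : 0 < orient3 (w n) (w 0) (w 1)) :
    ∀ i j k, i < j → j < k → k < n + 1 → 0 < orient3 (w i) (w j) (w k) := by
  intro i j k hij hjk hk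
  rcases Nat.lt_or_ge k n with hkn | hkn
  · exact hw i j k hij hjk hkn
  have hk' : k = n := by omega
  rw [hk']
  -- the new triples `(i, j, n)`
  rcases Nat.lt_or_ge j (n - 1) with hjn | hjn
  swap
  · have hj' : j = n - 1 := by omega
    rw [hj']
    exact convexPos_snoc_last hn hw h1 h2 (by omega)
  rcases Nat.eq_zero_or_pos i with rfl | hi0
  · exact convexPos_snoc_zero hn hw h2 h3 hij (by omega)
  -- general `1 ≤ i < j ≤ n - 2`: Plücker at hub p = w i: a = w j, b = w n, c = w (n-1), x = w 0
  have hP := orient3_three_term (w i) (w j) (w n) (w (n - 1)) (w 0)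
  have s1 : 0 < orient3 (w i) (w (n - 1)) (w 0) :=
    convexPos_cyclic₁ hw (i := 0) (j := i) (k := n - 1) hi0 (by omega) (by omega)
  have s2 : 0 < orient3 (w i) (w (n - 1)) (w n) := convexPos_snoc_last hn hw h1 h2 (by omega)
  have s3 : 0 < orient3 (w i) (w j) (w 0) :=
    convexPos_cyclic₁ hw (i := 0) (j := i) (k := j) hi0 hij (by omega)
  have s4 : 0 < orient3 (w i) (w j) (w (n - 1)) := hw i j (n - 1) hij hjn (by omega)
  have s5 : 0 < orient3 (w i) (w n) (w 0) := by
    rw [← orient3_cyclic]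
    exact convexPos_snoc_zero hn hw h2 h3 hi0 (by omega)
  have hpos : 0 < orient3 (w i) (w j) (w n) * orient3 (w i) (w (n - 1)) (w 0) := by
    rw [hP]; nlinarith
  by_contra hle
  push Not at hle
  nlinarith

end Ear

/-! ## Two-piece gluing -/

section Glue

variable {n m : ℕ} {w : ℕ → EuclideanSpace ℝ (Fin 3)}

/-- The intermediate corner condition at `w 0` while gluing the second polygon vertex by vertex:
if the cycle `w (n−1), w n, …, w (n+m−1), w 0` is in convex position (as far as the triples
through `w 0` go), `0 < orient3 (w 0) (w 1) (w (n−1))` and the final corner at `w 0` is convex,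
`0 < orient3 (w (n+m−1)) (w 0) (w 1)`, then every intermediate corner is:
`0 < orient3 (w (n+s)) (w 0) (w 1)` for `s < m` (Plücker at hub `w 0`). -/
theorem convexPos_glue_corner (hn : 1 ≤ n) (hm : 1 ≤ m)
    (hQ0 : ∀ i j, n - 1 ≤ i → i < j → j < n + m → 0 < orient3 (w i) (w j) (w 0))
    (h01 : 0 < orient3 (w 0) (w 1) (w (n - 1)))
    (h3 : 0 < orient3 (w (n + m - 1)) (w 0) (w 1)) {s : ℕ} (hs : s < m) :
    0 < orient3 (w (n + s)) (w 0) (w 1) := by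
  rcases Nat.lt_or_ge s (m - 1) with hs1 | hs1
  swap
  · have hs' : n + s = n + m - 1 := by omega
    rw [hs']; exact h3
  -- Plücker at hub p = w 0: a = w 1, b = w (n+s), c = w (n-1), x = w (n+m-1)
  have hP := orient3_three_term (w 0) (w 1) (w (n + s)) (w (n - 1)) (w (n + m - 1))
  have t1 : 0 < orient3 (w 0) (w (n - 1)) (w (n + m - 1)) := by
    rw [orient3_cyclic]; exact hQ0 (n - 1) (n + m - 1) le_rfl (by omega) (by omega)
  have t2 : 0 < orient3 (w 0) (w (n - 1)) (w (n + s)) := by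
    rw [orient3_cyclic]; exact hQ0 (n - 1) (n + s) le_rfl (by omega) (by omega)
  have t3 : 0 < orient3 (w 0) (w 1) (w (n + m - 1)) := by rw [← orient3_cyclic]; exact h3
  have t4 : 0 < orient3 (w 0) (w (n + s)) (w (n + m - 1)) := by
    rw [orient3_cyclic]; exact hQ0 (n + s) (n + m - 1) (by omega) (by omega) (by omega)
  have hpos : 0 < orient3 (w 0) (w 1) (w (n + s)) * orient3 (w 0) (w (n - 1)) (w (n + m - 1)) := by
    rw [hP]; nlinarith
  have : 0 < orient3 (w 0) (w 1) (w (n + s)) := by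
    by_contra hle
    push Not at hle
    nlinarith
  rw [orient3_cyclic]; exact this

/-- **TWO-PIECE GLUING.** Let `w 0, …, w (n−1)` (`n ≥ 3`) be in convex position; let the cycle
`w (n−1), w n, …, w (n+m−1), w 0` be in convex position — stated as: all increasing triples
among the indices `n−1, …, n+m−1` are positively oriented, and so are the triples `(i, j, 0)`
with `n−1 ≤ i < j ≤ n+m−1` (the second polygon shares the side `w (n−1) w 0` and lies on the
other side of it); and let the two corners of the union be convex:
`0 < orient3 (w (n−2)) (w (n−1)) (w n)` at `w (n−1)` and `0 < orient3 (w (n+m−1)) (w 0) (w 1)`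
at `w 0` (both vacuous demands when `m = 0`). Then `w 0, …, w (n+m−1)` is in convex position. -/
theorem convexPos_glue (hn : 3 ≤ n)
    (hP : ∀ i j k, i < j → j < k → k < n → 0 < orient3 (w i) (w j) (w k))
    (hQ : ∀ i j k, n - 1 ≤ i → i < j → j < k → k < n + m → 0 < orient3 (w i) (w j) (w k))
    (hQ0 : ∀ i j, n - 1 ≤ i → i < j → j < n + m → 0 < orient3 (w i) (w j) (w 0))
    (h1 : 1 ≤ m → 0 < orient3 (w (n - 2)) (w (n - 1)) (w n))
    (h3 : 1 ≤ m → 0 < orient3 (w (n + m - 1)) (w 0) (w 1)) :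
    ∀ i j k, i < j → j < k → k < n + m → 0 < orient3 (w i) (w j) (w k) := by
  -- by induction on the number `s ≤ m` of glued vertices
  suffices H : ∀ s, s ≤ m → ∀ i j k, i < j → j < k → k < n + s → 0 < orient3 (w i) (w j) (w k)
    from H m le_rfl
  intro s
  induction s with
  | zero => intro _; simpa using hP
  | succ s ih =>
    intro hs
    have hm : 1 ≤ m := by omega
    have ih' := ih (by omega)
    have h01 : 0 < orient3 (w 0) (w 1) (w (n - 1)) := hP 0 1 (n - 1) (by omega) (by omega) (by omega)
    -- glue the ear `w (n+s-1), w (n+s), w 0` onto `w 0, …, w (n+s-1)`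
    have hns : 3 ≤ n + s := by omega
    have e1 : 0 < orient3 (w (n + s - 2)) (w (n + s - 1)) (w (n + s)) := by
      rcases Nat.eq_zero_or_pos s with rfl | hs0
      · simpa using h1 hm
      · exact hQ (n + s - 2) (n + s - 1) (n + s) (by omega) (by omega) (by omega) (by omega)
    have e2 : 0 < orient3 (w (n + s - 1)) (w (n + s)) (w 0) :=
      hQ0 (n + s - 1) (n + s) (by omega) (by omega) (by omega)
    have e3 : 0 < orient3 (w (n + s)) (w 0) (w 1) := convexPos_glue_corner (by omega) hm hQ0 h01 (h3 hm) (by omega)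
    have := convexPos_snoc hns ih' e1 e2 e3
    intro i j k hij hjk hk
    exact this i j k hij hjk (by omega)

end Glue

end Summit.Ventures.Crystal3D

end
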